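import Summits.ResolutionOfSingularities.ResolutionOfSingularities.Theses.WeightedInvariant
import Summits.ResolutionOfSingularities.ResolutionOfSingularities.Theorems.WeightedInvariantWeightedConstructionStaticReduction

/-!
# The transfer stubs of the two live lines of crux `WeightedConstruction` ARE the crux

Route `ResolutionOfSingularities/WeightedInvariant`, crux `WeightedConstruction`
(stmt-ResolutionOfSingularities-0571, `∀ p prime, Nonempty (WeightedResolutionDatum p)`), line lead c5.

The crux chain built two lines whose only open stubs are "transfer" stubs:

* line `support-first-weights-second`: `∀ p prime, Nonempty (ACChartPreDatum p)` (drop `(iv)` demanded only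
  over algebraically closed ground fields, on weighted chart opens, at closed singular exceptional points;
  Theorems/…ACReduction.lean);
* line `no-phi-rays-static-drop`: `∀ p prime, Nonempty (StaticPreDatum p)` (drop `(iv)` replaced by
  restriction monotonicity `(R)` and the cone drop `(CI)`; Theorems/…StaticDefs.lean).

This file records, sorry-free and from landed reductions only, that the first transfer is literally
EQUIVALENT to the crux (`stub_acChartPreDatum_iff` (registered stub of line `support-first-weights-second`, lead c5 skeleton v7), `weightedConstruction_iff_acChartPreDatum`) and that
the second IMPLIES it (`weightedConstruction_of_staticPreDatum`, the line's landed `stub_staticReduction`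
prime by prime). So neither line has any content left besides the characteristic-`p` construction itself:
the reductions (verify the drop only on the exceptional divisor / only at closed points / only on chart opens /
only over `k̄` / only at singular points; Włodarczyk arXiv:2203.03090 §3.3.33 read backwards) are complete.
-/

noncomputable section

open CategoryTheory AlgebraicGeometry TopologicalSpace
open Literature.AlgebraicGeometry.Resolution
open Summit.ResolutionOfSingularities.ResolutionOfSingularities.Theses.WeightedInvariant

set_option linter.dupNamespace false -- mandated namespace of this single-conjunct summit

namespace Summit.ResolutionOfSingularities.ResolutionOfSingularities.Theorems

/-- **Algebraically-closed chart pre-data exist iff data exist** (same `Γ`, `inv`, `centre` both ways):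
`→` is the landed chain `acChartPreDatum_toPreDatum` ∘ `stub_preDatum_toDatum` (chart localisation, base
change to an algebraic closure, closed-point and off-exceptional reductions); `←` forgets
(`PreDatum.ofDatum`, `ACChartPreDatum.ofPreDatum`). -/
theorem stub_acChartPreDatum_iff :
    ∀ p : ℕ, Nonempty (ACChartPreDatum p) ↔ Nonempty (WeightedResolutionDatum p) :=
  fun p => ⟨fun h => stub_preDatum_toDatum p (acChartPreDatum_toPreDatum p h),
   fun ⟨D⟩ => ⟨ACChartPreDatum.ofPreDatum (PreDatum.ofDatum D)⟩⟩

/-- **The transfer stub of line `support-first-weights-second` is the crux**: the weighted construction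
holds iff for every prime `p` an algebraically-closed chart pre-datum exists. -/
theorem weightedConstruction_iff_acChartPreDatum :
    WeightedConstruction ↔ ∀ p : ℕ, p.Prime → Nonempty (ACChartPreDatum p) := by
  constructor
  · intro h p hp
    exact (stub_acChartPreDatum_iff p).mpr (h p hp)
  · intro h p hp
    exact (stub_acChartPreDatum_iff p).mp (h p hp)

/-- **The transfer stub of line `no-phi-rays-static-drop` implies the crux** (the line's landed
`stub_staticReduction`, prime by prime; the converse is not claimed — `(R)` and `(CI)` are stronger than
`(iv)`). -/
theorem weightedConstruction_of_staticPreDatum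
    (h : ∀ p : ℕ, p.Prime → Nonempty (StaticPreDatum p)) : WeightedConstruction :=
  fun p hp => stub_staticReduction p (h p hp)

/-- **A static pre-datum is in particular an algebraically-closed chart pre-datum** (so the static transfer
also implies the support-first transfer). -/
theorem nonempty_acChartPreDatum_of_staticPreDatum (p : ℕ) (h : Nonempty (StaticPreDatum p)) :
    Nonempty (ACChartPreDatum p) :=
  (stub_acChartPreDatum_iff p).mpr (stub_staticReduction p h)

end Summit.ResolutionOfSingularities.ResolutionOfSingularities.Theorems

end
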